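import Literature.AlgebraicGeometry.Motives.SupersingularAbelianVarietyProofs
import Literature.NumberTheory.DiophantineGeometry.AVKernelHopf
import HarnessLib

/-!
# Lefschetz classes transfer along isogenies

For a Weil cohomology theory `W : WeilCohomology k K` (Kleiman 1968, §1.2) and an isogeny
`f : A → B` of abelian varieties over `k`, the pull-back `f* : H•(B) → H•(A)` is onto: by the
tree's theorem `AbelianVariety.IsIsogeny.exists_nsmul_inverse_holds` (every isogeny has a
quasi-inverse `g` with `g ∘ f = [n]_A`, `n ≥ 1`; Mumford, *Abelian Varieties*, §19, Remark p. 169,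
proved in `Literature/NumberTheory/DiophantineGeometry/AVKernelHopf.lean` from Deligne's theorem
and fpqc descent) and `n_A* = nⁱ` on `Hⁱ(A)` (`surjective_pullback_of_comp_eq_pow`,
`Motives/SupersingularAbelianVarietyProofs`). Consequently, if every class in `H²ʳ(B)` is a
Lefschetz class, so is every class in `H²ʳ(A)` (`lefschetzClasses_eq_top_of_isIsogeny`,
`lefschetzClasses_eq_top_of_isIsogenous`) — the isogeny step `A ∼ Eᵍ` of Lenstra–Zarhin's remark
(1993, §1, p. 179) recorded in `Motives/SupersingularAbelianVariety`, now unconditional.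

Everything is a theorem; no definitions, no named facts.

## References

* [MumfordAV1970] D. Mumford, *Abelian Varieties* (1970), §19, Remark p. 169.
* [LenstraZarhin1993] H. W. Lenstra, Jr., Yu. G. Zarhin, Advances in Number Theory (1993), §1,
  p. 179.
* [Kleiman1968] S. Kleiman, *Algebraic cycles and the Weil conjectures* (1968), §1.2, 2A.
-/

noncomputable section

universe u v

open CategoryTheory AlgebraicGeometry

namespace Literature.AlgebraicGeometry.Motives

namespace WeilCohomology

variable {k : Type u} [Field k] {K : Type v} [Field K] [CharZero K] (W : WeilCohomology k K)

open scoped MonObj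

/-- The underlying `k`-morphism of `[n]_A = n • 𝟙 A` (`n : ℕ`) is the `n`-th power of the
identity in the convolution monoid of `k`-morphisms `A.X ⟶ A.X` (`AbelianVariety.hom_zsmul_id`
for `n : ℤ`). [folklore] -/
theorem _root_.Literature.AlgebraicGeometry.Motives.AbelianVariety.hom_nsmul_id
    (A : AbelianVariety k) (n : ℕ) : (n • 𝟙 A).hom.hom.hom = (𝟙 A.X) ^ n := by
  rw [← natCast_zsmul, AbelianVariety.hom_zsmul_id, zpow_natCast]

/-- **Pull-back along an isogeny is onto.** For an isogeny `f : A → B` of abelian varieties and a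
Weil cohomology theory `W`, `f* : Hⁱ(B) → Hⁱ(A)` is surjective for every `i`: a quasi-inverse
`g` with `g ∘ f = [n]_A`, `n ≥ 1` (`IsIsogeny.exists_nsmul_inverse_holds`, Mumford §19, Remark
p. 169) gives `f* ∘ g* = n_A* = nⁱ` on `Hⁱ(A)` (`surjective_pullback_of_comp_eq_pow`).
[cite: MumfordAV1970, §19 Remark p. 169] -/
theorem surjective_pullback_of_isIsogeny {A B : AbelianVariety k} {f : A ⟶ B}
    (hf : AbelianVariety.IsIsogeny f) (i : ℕ) :
    Function.Surjective (W.pullback f.hom.hom.hom i) := by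
  obtain ⟨g, n, hn, hfg, -⟩ := AbelianVariety.IsIsogeny.exists_nsmul_inverse_holds hf
  refine W.surjective_pullback_of_comp_eq_pow A B f.hom.hom.hom g.hom.hom.hom hn.ne' ?_ i
  have h := congrArg (fun φ : A ⟶ A ↦ φ.hom.hom.hom) hfg
  simp only at h
  rw [AbelianVariety.hom_nsmul_id] at h
  exact h

/-- **Lefschetz classes transfer along an isogeny**: if `f : A → B` is an isogeny of abelian
varieties and every class in `H²ʳ(B)` is a Lefschetz class, then so is every class in `H²ʳ(A)`
(`f*` is onto and maps Lefschetz classes to Lefschetz classes). This is the isogeny step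
`A ∼ Eᵍ` of Lenstra–Zarhin 1993, §1, p. 179. [cite: LenstraZarhin1993, §1 p. 179] -/
theorem lefschetzClasses_eq_top_of_isIsogeny {A B : AbelianVariety k} {f : A ⟶ B}
    (hf : AbelianVariety.IsIsogeny f) (r : ℕ) (hB : W.lefschetzClasses B.X r = ⊤) :
    W.lefschetzClasses A.X r = ⊤ :=
  W.lefschetzClasses_eq_top_of_surjective AbelianVariety.isSmoothProjective_holds
    AbelianVariety.isSmoothProjective_holds f.hom.hom.hom r
    (W.surjective_pullback_of_isIsogeny hf (2 * r)) hB

/-- **Lefschetz classes transfer along isogeny of abelian varieties** (`IsIsogenous A B`: there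
is an isogeny `A → B`). [cite: LenstraZarhin1993, §1 p. 179] -/
theorem lefschetzClasses_eq_top_of_isIsogenous {A B : AbelianVariety k}
    (h : AbelianVariety.IsIsogenous A B) (r : ℕ) (hB : W.lefschetzClasses B.X r = ⊤) :
    W.lefschetzClasses A.X r = ⊤ := by
  obtain ⟨f, hf⟩ := h
  exact W.lefschetzClasses_eq_top_of_isIsogeny hf r hB

end WeilCohomology

end Literature.AlgebraicGeometry.Motives

end
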